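import Summits.BirchSwinnertonDyer.BirchSwinnertonDyer.Theorems.ErratumRoadFiveNonSurjCornerBranchesDefs
import Summits.BirchSwinnertonDyer.BirchSwinnertonDyer.Theorems.ErratumRoadFiveNonSurjCornerTwinKatoFacts
import Summits.BirchSwinnertonDyer.BirchSwinnertonDyer.Theorems.ErratumRoadFiveNonSurjCornerMuTransferMult
import HarnessLib

/-!
# Route `ErratumRoadFive` (rung K2, `p ≥ 5`), crux 6 `NonSurjCorner` (item stmt-BirchSwinnertonDyer-19065):
# the GLUE VARIANT with the ANALYTIC child — `nonSurjCorner_of_branchesAn : NonSurjCornerKolyZ → NonSurjCornerKolyJ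
# → NonSurjCornerTwinMuAn → KatoTwinFactsFiveAn → X11aLowerHalf → NonSurjCorner`, through the Kato `μ`-transfer at
# `p ∥ N` WITHOUT big image (cell `bsd-stepL`, seat `bsd-stepL-corner-p1` g6; planner g28 ruling (B) (c3) «one
# shape for μ»; `--supports stmt-BirchSwinnertonDyer-19065`)

Companion of `Theorems/ErratumRoadFiveNonSurjCornerBranches.lean` (the glue with the LITERAL child TwinMu = Greenberg's
`μ = 0` at the leaf twins). Here the third child is `NonSurjCornerTwinMuAn` (file `…BranchesDefs.lean`): at every
non-surjective X11a leaf twin `Wd`, SOME coefficient of the Néron-normalised Mazur–Tate–Teitelbaum function `ϖ·L`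
is a `p`-adic unit — rung K6's `AnalyticMuZeroX9` shape at a multiplicative prime, PER PAIR a finite exact
modular-symbol certificate. The transfer `μ(ϖ·L) = 0 ⟹ μ(X(Wd/ℚ_∞)) = 0` is this seat's
`X11b.MultMu.mu_eq_zero_of_multFine` (file `…MuTransferMult.lean`, p487898; core `CoreAssembly.coreOdd_anyReduction_holds`
p486975), modulo ONE further named fact, Kato's §17.13 package at `p ∥ N` with the fine quotient
(`Kato2004.exists_multDivisibilityInputs_fine`, p487500 — the F1 of this road, exactly as K6 rests on its F1); so the
support bundle of this variant, `KatoTwinFactsFiveAn`, is the twenty-two facts of `KatoTwinFactsFive` PLUS that one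
(twenty-three conjuncts, in that order; again written as ONE conjunction binder whose text the planner pastes).

* §1 `X11b.multDivisibilityAt_of_katoFacts_of_muAn` — x11c's typed `MultDivisibilityAt Wd p` at an odd multiplicative
  pair with `E[p]` irreducible and `ρ̄` not onto, from the six Kato∕Greenberg∕Wuthrich facts, F1-mult and the ANALYTIC
  certificate (unit coefficient of `ϖ·L` for every newform, `ϖ`, `L`): g5's
  `multDivisibilityAt_of_katoMultRat_of_integral_of_mu_eq_zero` with `μ = 0` produced INSIDE each sign branch by the
  transfer, at the `(f, ϖ, L)` in scope — so no period-ratio existence statement is needed.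
* §2 **`nonSurjCorner_of_branchesAn`** — the glue: Zₚᶜ → Jₚᶜ → TwinMuAn → ⟨23-fact conjunction⟩ → X11aLowerHalf →
  `Theses.ErratumRoadFive.NonSurjCorner` BY NAME (g4's `…_of_refinedKolyvagin_of_lowerX11a_of_twinMultDivisibility`,
  p454452, with `hdiv` from §1). No aside consumed.

READING (planner, (c3)): choosing TwinMuAn as the child makes the corner's twin summand LITERALLY K6-shaped: transfer
kernel-checked modulo a Kato construction fact, residual = analytic `μ = 0` (per-pair decidable), class-wide =
Greenberg Conj. 1.11 via the main conjecture. Choosing TwinMu keeps Greenberg's algebraic statement (no F1-mult in the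
bundle). Both glues are landed; the choice is the planner's at edit time.

HONEST FRAMING: two theorems (no definition, no named fact minted here, no `sorry`); CONDITIONAL on the displayed
hypotheses (three OPEN branches, twenty-three named facts — three of them CONSTRUCTION facts —, the OPEN crux 19064);
nothing asserted about any curve; nothing booked; item 19065 does NOT close; BSD is not advanced; no census word moves
(T7). Flag `Cha05-Rmk25-structure` rides on §2; flags `Kato-17.11-at-{nonsplit,split}-mult`, `Kato-p280-image-at-mult`
ride on F1-mult.

References: [Kato2004Asterisque] Thm. 12.4–12.6, (14.9.3), §17.13 (pp. 279–280); [Wuthrich2014] p. 391, Cor. 18;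
[Kobayashi2006DocMath] Thm. 4.1; [GreenbergLNM1716] Thm. 1.5, §1 Conj. 1.11; [Cha2005] Thm. 21, Rmk. 25;
[MatarNekovar2019] §0.9–0.11; [McCallumLMS1991] §5; [WZhang2014] Thm. 1.1; [Jetchev2008] Conj. 1.3;
[SteinWuthrich2013] Thm. 6.1; [MazurTateTeitelbaum1986] §I.10, §I.14.
-/

set_option autoImplicit false
set_option linter.dupNamespace false

noncomputable section

open scoped Classical NumberField MatrixGroups ModularForm

open CongruenceSubgroup WeierstrassCurve NumberField IsDedekindDomain Field
  Literature.NumberTheory.EllipticCurves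
  Literature.NumberTheory.EllipticCurves.ModularForms
  Literature.NumberTheory.EllipticCurves.Rank1Residual
  Literature.NumberTheory.EllipticCurves.Rank1Residual.Typed
  Literature.NumberTheory.EllipticCurves.Wuthrich2014
  Literature.NumberTheory.EllipticCurves.SteinWuthrich2013
  Literature.NumberTheory.EllipticCurves.Greenberg1999
  Literature.NumberTheory.EllipticCurves.Kato2004
  Literature.NumberTheory.QuadraticFields.Quadratic
  Summit.BirchSwinnertonDyer.Rank1Residual
  Summit.BirchSwinnertonDyer.Rank1Residual.X11b.Three.Koly
  Summit.BirchSwinnertonDyer.Rank1Residual.X5.O1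

namespace Summit.BirchSwinnertonDyer.Rank1Residual.X11b

/-! ### §1 The twin's typed divisibility from the ANALYTIC certificate -/

/-- **`X11b.MultDivisibilityAt W p` at an odd multiplicative pair with `E[p]` irreducible and `ρ̄` NOT onto, from
NAMED facts and the ANALYTIC `μ = 0` certificate.** Facts: `hne` Kato (12.2.1), `h12` Thm. 12.4, `hns`/`hsp` the
§17.13 inputs at a non-split ∕ split multiplicative odd prime, `h15` Greenberg 1999 Thm. 1.5, `h18` Wuthrich 2014
Cor. 18, `hfine` the §17.13 package with the fine quotient at `p ∥ N` (F1-mult). Certificate `hAn`: for every newform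
`f` of `W`, every `ϖ` with `ϖ·Ω_W = Ω⁺_f` and every MTT function `L` (`a = ±1` by the reduction type), some
coefficient of `ϖ·L` is a `p`-adic unit. Proof: g5's chain (`MultKatoRat.katoMultiplicativeDivisibilityRat_of_facts_odd`
for the `⊗ℚ` shape, Cor. 18 for `ϖ·L ∈ Λ`, `mem_charIdeal_of_katoRat_of_integral_of_mu_eq_zero[_split]` for the
absorption) with `D.mu = 0` supplied IN EACH SIGN BRANCH by the transfer `MultMu.mu_eq_zero_of_multFine` at the
`(f, ϖ, L)` in scope. NO `μ = 0` hypothesis, NO image hypothesis beyond `Irr ∧ ¬Surj`, NO (ram).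
[cite: Kato2004Asterisque, Thm. 12.4 (p. 221), Thm. 12.6 (p. 222), (14.9.3) (p. 240), §17.13 (pp. 279–280)]
[cite: Wuthrich2014, p. 391 and Cor. 18 (p. 398)] [cite: GreenbergLNM1716, Thm. 1.5 (p. 61)]
[cite: Kobayashi2006DocMath, Thm. 4.1] [cite: Rubin1998Durham, Prop. A.2 (iii)] -/
theorem multDivisibilityAt_of_katoFacts_of_muAn
    (hne : Kato2004.nonempty_iwasawaH1Data) (h12 : Kato2004.thm12_4)
    (hns : Kato2004.exists_multDivisibilityInputs_nonsplit)
    (hsp : Kato2004.exists_multDivisibilityInputs_split)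
    (h15 : thm15_isTorsion_multiplicative_rat)
    (h18 : Wuthrich2014.corollary18_padicLFunction_mem_iwasawaAlgebra_multiplicative)
    (hfine : Kato2004.exists_multDivisibilityInputs_fine)
    (W : WeierstrassCurve ℚ) [W.IsElliptic] [W.IsGloballyMinimal] (p : ℕ) [Fact p.Prime]
    (hp : p ≠ 2) (hmult : Mult W p) (hirr : Irr W p) (hnsurj : ¬ Surj W p)
    (hAn : ∀ {N : ℕ} [NeZero N] (f : CuspForm (Gamma0 N) 2), IsNewformOf W f →
      ∀ (ϖ : ℚ), (ϖ : ℝ) * W.realPeriodRat = plusPeriod f →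
      ∀ (a : ℚ_[p]) (L : PowerSeries ℚ_[p]),
        (W.HasSplitMultiplicativeReductionAtPrime p → a = 1) →
        (¬ W.HasSplitMultiplicativeReductionAtPrime p → a = -1) →
        IsMultPAdicLFunctionOf f p a L →
        ∃ n : ℕ, ‖PowerSeries.coeff n (PowerSeries.C ((ϖ : ℚ) : ℚ_[p]) * L)‖ = 1) :
    MultDivisibilityAt W p := by
  have hK : KatoMultiplicativeDivisibilityRat W p :=
    Summit.BirchSwinnertonDyer.BirchSwinnertonDyer.Theorems.MultKatoRat.katoMultiplicativeDivisibilityRat_of_facts_odd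
      W p hp hne h12 hns hsp h15
  intro κ γ N _ f hκ hγ hγ' hf D ϖ _hϖ0 hϖ
  obtain ⟨hX, hnsK, hsK⟩ := hK κ γ hκ hγ hγ' hmult f hf D
  obtain ⟨hint_ns, hint_s⟩ := h18 W p hp hmult hf ϖ hϖ
  refine ⟨hX, fun hn L hL => ?_, fun hsplit L hL => ?_⟩
  · have hμD : D.mu = 0 :=
      MultMu.mu_eq_zero_of_multFine hfine h18 W p f hp hmult hirr hnsurj hf ϖ hϖ (-1) L
        (fun hs => absurd hs hn) (fun _ => rfl) hL
        (hAn f hf ϖ hϖ (-1) L (fun hs => absurd hs hn) (fun _ => rfl) hL) κ γ hκ hγ hγ' D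
    obtain ⟨n, g, hg, hι⟩ := hnsK hn L hL
    obtain ⟨G, hG⟩ := hint_ns hn L hL
    exact ⟨G, mem_charIdeal_of_katoRat_of_integral_of_mu_eq_zero hγ D hX hμD hg hι hG, hG⟩
  · have hL1 : IsMultPAdicLFunctionOf f p 1 L := (isMultPAdicLFunctionOf_one_iff L).mpr hL
    have hμD : D.mu = 0 :=
      MultMu.mu_eq_zero_of_multFine hfine h18 W p f hp hmult hirr hnsurj hf ϖ hϖ 1 L
        (fun _ => rfl) (fun hns' => absurd hsplit hns') hL1
        (hAn f hf ϖ hϖ 1 L (fun _ => rfl) (fun hns' => absurd hsplit hns') hL1) κ γ hκ hγ hγ' D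
    obtain ⟨n, g, hg, hι⟩ := hsK hsplit L hL
    obtain ⟨G, hG⟩ := hint_s hsplit L hL
    exact exists_mem_charIdeal_of_katoRat_of_integral_of_mu_eq_zero_split hγ D hX hμD hg hι hG

end Summit.BirchSwinnertonDyer.Rank1Residual.X11b

namespace Summit.BirchSwinnertonDyer.BirchSwinnertonDyer.Theorems

open Summit.BirchSwinnertonDyer.Rank1Residual.X11b

/-! ### §2 The glue variant with the analytic child -/

/-- **GLUE VARIANT of the split of crux 6 `NonSurjCorner` (item 19065) with the ANALYTIC child: Zₚᶜ → Jₚᶜ →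
TwinMuAn → `KatoTwinFactsFiveAn` → `X11aLowerHalf` (19064) → `NonSurjCorner`.** The bundle binder `hF` is the
conjunction of the twenty-two facts of `KatoTwinFactsFive` (in the order of `nonSurjCorner_of_branches`) followed by
the twenty-third, `Kato2004.exists_multDivisibilityInputs_fine` (F1 at `p ∥ N`). Proof: g4's
`X11b.erratumRoadFive_nonSurjCorner_of_refinedKolyvagin_of_lowerX11a_of_twinMultDivisibility` (p454452) with the twin
divisibility `hdiv` from §1 and the analytic child; `ClassX11a` supplies `p ≠ 2`, `Mult`, `Irr`. CONDITIONAL;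
closes nothing by itself. [cite: Cha2005, Thm. 21 and Rmk. 25 (pp. 173–175)]
[cite: MatarNekovar2019, §0.9 and §0.11 (pp. 456–457)] [cite: Kato2004Asterisque, Thm. 12.6 (p. 222) and §17.13 (pp. 279–280)]
[cite: Wuthrich2014, Cor. 18 (p. 398)] [cite: GreenbergLNM1716, §1 Conj. 1.11 (shape)] -/
theorem nonSurjCorner_of_branchesAn (hZ : NonSurjCornerKolyZ) (hJ : NonSurjCornerKolyJ)
    (hμ : NonSurjCornerTwinMuAn)
    (hF :
      (∀ (N : ℕ) [NeZero N] (W : WeierstrassCurve ℚ) (K : Type) [Field K] [NumberField K], gross_zagier N W K) ∧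
      (∀ (N : ℕ) [NeZero N] (W : WeierstrassCurve ℚ) (K : Type) [Field K] [NumberField K], kolyvagin N W K) ∧
      sha_dvd_analyticSha ∧
      rank_eq_analyticRank_of_analyticRank_le_one ∧
      WeierstrassCurve.hasEntireLFunction_rat ∧
      exists_isNewformOf ∧
      nonempty_modularParametrizationData ∧
      friedbergHoffstein_exists_heegnerField_split_twist_ne_zero ∧
      mazur_not_dvd_maninConstant_of_odd ∧
      (∀ (N : ℕ) [NeZero N] (W : WeierstrassCurve ℚ) (K : Type) [Field K] [NumberField K],
        heegnerPointOfConductor_one_galoisConj N W K) ∧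
      (∀ (N : ℕ) [NeZero N] (W : WeierstrassCurve ℚ) (K : Type) [Field K] [NumberField K],
        phi_heegnerTau_mem_singularModuliField N W K) ∧
      thm61_splitMultiplicative ∧
      thm61_nonsplitMultiplicative ∧
      (∀ (W : WeierstrassCurve ℚ) [W.IsElliptic] [W.IsGloballyMinimal] (p : ℕ) [Fact p.Prime],
        greenberg_stevens (W := W) (p := p)) ∧
      Cha2005.rmk25_pow_dvd_card_sha_primary_of_certificate ∧
      Cha2005.rmk25_padicValNat_card_sha_primary_add_le_of_globalDivisibility ∧
      Kato2004.nonempty_iwasawaH1Data ∧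
      Kato2004.thm12_4 ∧
      Kato2004.exists_multDivisibilityInputs_nonsplit ∧
      Kato2004.exists_multDivisibilityInputs_split ∧
      thm15_isTorsion_multiplicative_rat ∧
      Wuthrich2014.corollary18_padicLFunction_mem_iwasawaAlgebra_multiplicative ∧
      Kato2004.exists_multDivisibilityInputs_fine)
    (h₄ : Summit.BirchSwinnertonDyer.BirchSwinnertonDyer.Theses.ErratumRoadFive.X11aLowerHalf) :
    Summit.BirchSwinnertonDyer.BirchSwinnertonDyer.Theses.ErratumRoadFive.NonSurjCorner := by
  obtain ⟨hGZ, hKo, hWu, hGZK, hmod, hnf, hpar, hFHs, hMaz, hrec, hD36, hJs, hJn, hGS, hChaL, hChaU, hne, h12,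
    hns, hsp, h15, h18, hfine⟩ := hF
  exact erratumRoadFive_nonSurjCorner_of_refinedKolyvagin_of_lowerX11a_of_twinMultDivisibility hGZ hKo hWu hGZK
    hmod hnf hpar hFHs hMaz hrec hD36 hJs hJn hGS hChaL hChaU h₄
    (fun W _ _ p _ N _ K _ _ Dt β ι ↦ hZ W p N K Dt β ι) (fun W _ _ _ p _ K _ _ Dt β ι ↦ hJ W p K Dt β ι)
    (fun Wd _ _ p _ hXa hnsd h57 hvd ↦
      multDivisibilityAt_of_katoFacts_of_muAn hne h12 hns hsp h15 h18 hfine Wd p hXa.2.1 hXa.2.2.1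
        hXa.2.2.2.1 hnsd (fun f hf ϖ hϖ a L hsa hna hL ↦ hμ Wd p hXa hnsd h57 hvd f hf ϖ hϖ a L hsa hna hL))

end Summit.BirchSwinnertonDyer.BirchSwinnertonDyer.Theorems

end
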